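import Summits.ValiantsHypothesis.ValiantsHypothesis.Theses.OneNatPerBit
import Literature.Analysis.Matrix.PermanentHadamard

/-!
# Route OneNatPerBit — `MonotoneDepthThree` (item stmt-ValiantsHypothesis-10325)

Monotone set-multilinear `ΣΠΣ` obeys the one-nat-per-bit law with exponent `1`: for non-negative
arrays `a_t` (`t < T`),

  `(Σ_t Σ_σ Π_i a_{t,i,σ i})² · nⁿ ≤ T · (n!)² · Σ_φ (Σ_t Π_i a_{t,i,φ i})²`,

i.e. `corr²(Σ_t Π_i ℓ_{t,i}, per_n) ≤ T · n!/nⁿ`.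

Proof (as planned by the route): per term the Carlen–Lieb–Loss inequality
`perm(A)² · nⁿ ≤ (n!)² · Π_i Σ_j A_{ij}²` (Theorem 1.1 of [CarlenLiebLoss2006], DISCHARGED in the
tree as `Literature.Analysis.Matrix.real_subperm_sq_le`, case `K = N`), Cauchy–Schwarz over `t`
(`(Σ_t p_t)² ≤ T · Σ_t p_t²`), and positivity of the cross terms:
`Σ_t Π_i Σ_j a_{t,i,j}² = Σ_φ Σ_t (Π_i a_{t,i,φ i})² ≤ Σ_φ (Σ_t Π_i a_{t,i,φ i})²`.
-/

-- `Summit.ValiantsHypothesis.ValiantsHypothesis.…` is the tree's mandated single-conjunct layout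
-- (Sub = Summit), so the duplicated namespace component is intended.
set_option linter.dupNamespace false

namespace Summit.ValiantsHypothesis.ValiantsHypothesis.Theorems.OneNatPerBitMonotoneDepthThree

open scoped BigOperators

/-- **Carlen–Lieb–Loss for real square arrays, row form**: for every real `n × n` array `A`,
`(Σ_σ Π_i A i (σ i))² · nⁿ ≤ (n!)² · Π_i Σ_j (A i j)²` — the case `K = N` of the tree's
`Literature.Analysis.Matrix.real_subperm_sq_le` (each of the `n!` injective `n`-tuples `e` is a
permutation, and `perm (A ∘ e) = perm A = Σ_σ Π_i A i (σ i)` by `Matrix.permanent_permute_rows`,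
`Matrix.permanent_transpose`). [cite: CarlenLiebLoss2006, Thm. 1.1] -/
theorem sq_sum_perm_prod_mul_pow_le (n : ℕ) (A : Matrix (Fin n) (Fin n) ℝ) :
    (∑ σ : Equiv.Perm (Fin n), ∏ i, A i (σ i)) ^ 2 * (n : ℝ) ^ n ≤
      (n.factorial : ℝ) ^ 2 * ∏ i, ∑ j, A i j ^ 2 := by
  have h := Literature.Analysis.Matrix.real_subperm_sq_le n n A
  have hperm : A.permanent = ∑ σ : Equiv.Perm (Fin n), ∏ i, A i (σ i) := by
    rw [← Matrix.permanent_transpose]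
    rfl
  have hterm : ∀ e : Fin n ↪ Fin n,
      (A.submatrix id ⇑e).permanent = ∑ σ : Equiv.Perm (Fin n), ∏ i, A i (σ i) := by
    intro e
    have hbij : Function.Bijective e := e.injective.bijective_of_finite
    have h1 : A.submatrix id ⇑e = A.submatrix id ⇑(Equiv.ofBijective e hbij) := rfl
    rw [h1, Matrix.permanent_permute_rows, hperm]
  simp only [hterm, Finset.sum_const, Finset.card_univ, Fintype.card_embedding_eq,
    Fintype.card_fin, Nat.descFactorial_self, nsmul_eq_mul] at h
  have hpos : (0 : ℝ) < n.factorial := by exact_mod_cast n.factorial_pos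
  have key : (n.factorial : ℝ) * ((∑ σ : Equiv.Perm (Fin n), ∏ i, A i (σ i)) ^ 2 * (n : ℝ) ^ n) ≤
      (n.factorial : ℝ) * ((n.factorial : ℝ) ^ 2 * ∏ i, ∑ j, A i j ^ 2) := by
    calc (n.factorial : ℝ) * ((∑ σ : Equiv.Perm (Fin n), ∏ i, A i (σ i)) ^ 2 * (n : ℝ) ^ n)
        = (n.factorial : ℝ) * (∑ σ : Equiv.Perm (Fin n), ∏ i, A i (σ i)) ^ 2 * (n : ℝ) ^ n := by
          ring
      _ ≤ (n.factorial : ℝ) ^ 2 * (n.factorial : ℝ) * ∏ i, ∑ j, A i j ^ 2 := h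
      _ = _ := by ring
  exact le_of_mul_le_mul_left key hpos

/-- **Positivity of the cross terms**: for non-negative arrays,
`Σ_t Π_i Σ_j a_{t,i,j}² ≤ Σ_φ (Σ_t Π_i a_{t,i,φ i})²` (expand each product of sums over
functions `φ : Fin n → Fin n`, swap the sums, and drop the non-negative cross terms
`Σ_t c_t² ≤ (Σ_t c_t)²`). [folklore] -/
theorem sum_prod_sum_sq_le (n T : ℕ) (a : Fin T → Fin n → Fin n → NNReal) :
    ∑ t, ∏ i, ∑ j, ((a t i j : ℝ)) ^ 2 ≤
      ∑ φ : Fin n → Fin n, (∑ t, ∏ i, (a t i (φ i) : ℝ)) ^ 2 := by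
  have hexp : ∀ t, ∏ i, ∑ j, ((a t i j : ℝ)) ^ 2 = ∑ φ : Fin n → Fin n, (∏ i, (a t i (φ i) : ℝ)) ^ 2 :=
    fun t => by
    rw [Fintype.prod_sum (fun i j => ((a t i j : ℝ)) ^ 2)]
    refine Finset.sum_congr rfl fun φ _ => ?_
    rw [Finset.prod_pow]
  simp only [hexp]
  rw [Finset.sum_comm]
  refine Finset.sum_le_sum fun φ _ => ?_
  exact Finset.sum_sq_le_sq_sum_of_nonneg fun t _ => Finset.prod_nonneg fun i _ => NNReal.coe_nonneg _

/-- **`MonotoneDepthThree`** (item stmt-ValiantsHypothesis-10325 of route OneNatPerBit): for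
non-negative arrays `a_t`, `(Σ_t Σ_σ Π_i a_{t,i,σ i})² · nⁿ ≤ T · (n!)² · Σ_φ (Σ_t Π_i a_{t,i,φ i})²`
— Carlen–Lieb–Loss per term, Cauchy–Schwarz over `t`, positivity of cross terms.
[cite: CarlenLiebLoss2006, Thm. 1.1] -/
theorem monotoneDepthThree_proof :
    Summit.ValiantsHypothesis.ValiantsHypothesis.Theses.OneNatPerBit.MonotoneDepthThree := by
  unfold Summit.ValiantsHypothesis.ValiantsHypothesis.Theses.OneNatPerBit.MonotoneDepthThree
  intro n T a
  -- per-term CLL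
  have hCLL : ∀ t, (∑ σ : Equiv.Perm (Fin n), ∏ i, (a t i (σ i) : ℝ)) ^ 2 * (n : ℝ) ^ n ≤
      (n.factorial : ℝ) ^ 2 * ∏ i, ∑ j, ((a t i j : ℝ)) ^ 2 :=
    fun t => sq_sum_perm_prod_mul_pow_le n (fun i j => (a t i j : ℝ))
  -- Cauchy–Schwarz over `t`
  have hCS : (∑ t, ∑ σ : Equiv.Perm (Fin n), ∏ i, (a t i (σ i) : ℝ)) ^ 2 ≤
      (T : ℝ) * ∑ t, (∑ σ : Equiv.Perm (Fin n), ∏ i, (a t i (σ i) : ℝ)) ^ 2 := by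
    have := sq_sum_le_card_mul_sum_sq (s := (Finset.univ : Finset (Fin T)))
      (f := fun t => ∑ σ : Equiv.Perm (Fin n), ∏ i, (a t i (σ i) : ℝ))
    simpa using this
  have hnn : (0 : ℝ) ≤ (n : ℝ) ^ n := by positivity
  have hcross := sum_prod_sum_sq_le n T a
  calc (∑ t, ∑ σ : Equiv.Perm (Fin n), ∏ i, (a t i (σ i) : ℝ)) ^ 2 * (n : ℝ) ^ n
      ≤ ((T : ℝ) * ∑ t, (∑ σ : Equiv.Perm (Fin n), ∏ i, (a t i (σ i) : ℝ)) ^ 2) * (n : ℝ) ^ n :=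
        mul_le_mul_of_nonneg_right hCS hnn
    _ = (T : ℝ) * ∑ t, (∑ σ : Equiv.Perm (Fin n), ∏ i, (a t i (σ i) : ℝ)) ^ 2 * (n : ℝ) ^ n := by
        rw [mul_assoc, Finset.sum_mul]
    _ ≤ (T : ℝ) * ∑ t, (n.factorial : ℝ) ^ 2 * ∏ i, ∑ j, ((a t i j : ℝ)) ^ 2 := by
        exact mul_le_mul_of_nonneg_left (Finset.sum_le_sum fun t _ => hCLL t) (Nat.cast_nonneg T)
    _ = (T : ℝ) * (n.factorial : ℝ) ^ 2 * ∑ t, ∏ i, ∑ j, ((a t i j : ℝ)) ^ 2 := by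
        rw [← Finset.mul_sum, mul_assoc]
    _ ≤ (T : ℝ) * (n.factorial : ℝ) ^ 2 *
          ∑ φ : Fin n → Fin n, (∑ t, ∏ i, (a t i (φ i) : ℝ)) ^ 2 := by
        gcongr

end Summit.ValiantsHypothesis.ValiantsHypothesis.Theorems.OneNatPerBitMonotoneDepthThree
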